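import Mathlib
import Summits.RiemannHypothesis.RiemannHypothesis.Theorems.SoloBlindMomentDetector

/-!
# Synthesis certificates: a deep pair is INVISIBLE behind any on-line crowd that can synthesise
# its signature (soloist `solo-RiemannHypothesis-blind`, artefact 15; report
# `paper/window-height.md` §11.8, THEOREM D10 (i), the weak-duality half, kernel form)

Setting (artefacts 12–14): the on-line lattice `sℤ` (`T′ = 2π/s`) with the site `0` replaced by the
off-line pair `∓iδ` (`Z₁(δ)`, artefact 12: for `g ∈ L²` supported in `(-a, a]`, `2a ≤ T′`, the zero-side
functional is `T′‖g‖² − |H(0)|² + 2 Re(H(−iδ) conj H(iδ))`, `H(z) = ∫ g(x) e^{izx} dx`), plus a *crowd*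
of finitely many on-line zeros `v_k` (ANY real positions) with multiplicities `m_k > 0`, contributing
`Σ m_k |H(v_k)|²`.

Artefact 14 (`soloBlind_momentDetector_visible`) is the DETECTION half of THEOREM D10 (i): an odd test
function orthogonal to low monomials sees the pair and is not seen by a confined crowd.  This file is
the dual SYNTHESIS half: if the pair's odd signature `sinh(δx)` on the window can be written as
`Σ A_k e^{i v_k x} + r(x)` with
`(∫_{(-a,a]} |r|²)/T′ + Σ |A_k|²/m_k ≤ 1/2`
(coefficients `A_k ∈ ℂ` arbitrary — an explicit *synthesis certificate*), then the functional of
`Z₁(δ) ∪ crowd` is `≥ 0` at EVERY odd `g ∈ L²` supported in the window: the pair is invisible to odd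
detectors (for a symmetric crowd, to all detectors, by the parity split of artefact 13 / §11.1; that
bookkeeping is not repeated here).  Proof: for odd `g`, `H(0) = 0`, `H(iδ) = −H(−iδ)` and
`H(−iδ) = ∫ g e^{δx} = ∫ g sinh(δx) = ∫ g r + Σ A_k H(v_k)`; two weighted AM–GM inequalities give
`2|H(−iδ)| ≤ λ (T′‖g‖² + Σ m_k|H(v_k)|²) + ((∫|r|²)/T′ + Σ|A_k|²/m_k)/λ` for every `λ > 0`, whence
(discriminant) `|H(−iδ)|² ≤ ½ (T′‖g‖² + Σ m_k|H(v_k)|²)`, which is the claim.  The report proves that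
the best certificate is EXACT (strong duality: the infimum over `A` of the certificate value equals
`⟨(T′ + Σ m_k |e_{v_k}⟩⟨e_{v_k}|)⁻¹ sinh, sinh⟩`), and uses explicit certificates to pin the fixed-width
crowding law `D* = (z*/2 + o(1)) log M / log log M`, `z* = 0.6627…`; only the inequality is certified
here.  Mathlib only (+ artefacts 12, 14 for the closed form and two small lemmas); no new definitions.
-/

open MeasureTheory Complex Set Finset
open scoped Real ComplexConjugate

namespace Summit.RiemannHypothesis.RiemannHypothesis.Theorems

/-- Weighted AM–GM: `2ab ≤ c·a² + b²/c` for `c > 0`. -/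
theorem soloBlind_two_mul_le_weighted (a b c : ℝ) (hc : 0 < c) :
    2 * a * b ≤ c * a ^ 2 + b ^ 2 / c := by
  rw [← sub_nonneg]
  have h : c * a ^ 2 + b ^ 2 / c - 2 * a * b = (c * a - b) ^ 2 / c := by
    field_simp
    ring
  rw [h]
  positivity

/-- From `2x ≤ λ·Y + J/λ` for every `λ > 0` (with `x, Y, J ≥ 0`) conclude `x² ≤ J·Y`
(the discriminant of the nonnegative quadratic `Y λ² − 2x λ + J`). -/
theorem soloBlind_sq_le_of_forall_amgm (x Y J : ℝ) (hx : 0 ≤ x) (hY : 0 ≤ Y) (hJ : 0 ≤ J)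
    (h : ∀ l : ℝ, 0 < l → 2 * x ≤ l * Y + J / l) : x ^ 2 ≤ J * Y := by
  have hq : ∀ l : ℝ, 0 ≤ Y * (l * l) + (-(2 * x)) * l + J := by
    intro l
    rcases le_or_gt l 0 with hl | hl
    · nlinarith [mul_nonneg hY (mul_self_nonneg l), mul_nonneg hx (neg_nonneg.mpr hl)]
    · have h1 := h l hl
      have h2 : 2 * x * l ≤ (l * Y + J / l) * l := mul_le_mul_of_nonneg_right h1 hl.le
      rw [add_mul, div_mul_cancel₀ _ hl.ne'] at h2
      nlinarith [h2]
  have hd := discrim_le_zero hq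
  rw [discrim] at hd
  nlinarith [hd]

/-- For an odd `g` and an even real weight `w`, `∫ g·w = 0`. -/
theorem soloBlind_odd_mul_even_integral {g : ℝ → ℂ} (hodd : ∀ x, g (-x) = -g x)
    {w : ℝ → ℝ} (heven : ∀ x, w (-x) = w x) :
    (∫ x : ℝ, g x * ((w x : ℝ) : ℂ)) = 0 := by
  have h := integral_neg_eq_self (fun x : ℝ => g x * ((w x : ℝ) : ℂ)) volume
  have h3 : (∫ x : ℝ, g (-x) * ((w (-x) : ℝ) : ℂ)) = -∫ x : ℝ, g x * ((w x : ℝ) : ℂ) := by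
    rw [← integral_neg]
    congr 1; funext x
    rw [hodd x, heven x]
    ring
  have h4 : (∫ x : ℝ, g x * ((w x : ℝ) : ℂ)) = -∫ x : ℝ, g x * ((w x : ℝ) : ℂ) := h.symm.trans h3
  linear_combination (1 / 2 : ℂ) * h4

/-- **Synthesis certificate ⟹ invisibility (THEOREM D10 (i), weak-duality half, kernel form).**
Configuration `Z₁(δ) ∪ crowd` as in artefact 14 (crowd points `v_k ∈ ℝ`, `k ∈ t`, arbitrary;
multiplicities `m_k > 0`), window `(-a, a]` with `2a ≤ 2π/s`.  If complex coefficients `A_k` satisfy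
`(∫_{(-a,a]} |sinh(δx) − Σ A_k e^{i v_k x}|² dx)/(2π/s) + Σ |A_k|²/m_k ≤ 1/2`, then the zero-side
functional is `≥ 0` at every ODD `g ∈ L²` supported in `(-a, a]`. -/
theorem soloBlind_synthesis_invisible (s δ a : ℝ) (hs : 0 < s) (haT : 2 * a ≤ 2 * π / s)
    {ι : Type*} (t : Finset ι) (v m : ι → ℝ) (hm : ∀ k ∈ t, 0 < m k) (A : ι → ℂ)
    {g : ℝ → ℂ} (hg : MemLp g 2 volume) (hsupp : Function.support g ⊆ Ioc (-a) a)
    (hodd : ∀ x, g (-x) = -g x)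
    (hcert : (∫ x in Ioc (-a) a, ‖((Real.sinh (δ * x) : ℝ) : ℂ)
          - ∑ k ∈ t, A k * cexp (I * ((v k : ℝ) : ℂ) * (x : ℂ))‖ ^ 2) / (2 * π / s)
        + ∑ k ∈ t, ‖A k‖ ^ 2 / m k ≤ 1 / 2) :
    0 ≤ (∑' j : ℤ, (if j = 0 then
        2 * ((∫ x : ℝ, g x * cexp (I * (((0 : ℝ) : ℂ) - I * δ) * (x : ℂ))) *
            conj ((∫ x : ℝ, g x * cexp (I * (((0 : ℝ) : ℂ) + I * δ) * (x : ℂ))))).re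
      else ‖(∫ x : ℝ, g x * cexp (I * ((((0 : ℝ) + j * s : ℝ) : ℂ)) * (x : ℂ)))‖ ^ 2))
      + ∑ k ∈ t, m k * ‖∫ x : ℝ, g x * cexp (I * ((v k : ℝ) : ℂ) * (x : ℂ))‖ ^ 2 := by
  have hTpos : 0 < 2 * π / s := by positivity
  -- integrability from `L²` and bounded support
  have hgi : Integrable g := by
    have hm2 : MemLp g 2 (volume.restrict (Ioc (-a) a)) := hg.restrict _
    haveI : IsFiniteMeasure (volume.restrict (Ioc (-a) a)) :=
      isFiniteMeasure_restrict.mpr (by simp [Real.volume_Ioc])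
    have h1 : IntegrableOn g (Ioc (-a) a) := hm2.integrable one_le_two
    exact (integrableOn_iff_integrable_of_support_subset hsupp).mp h1
  have hg2 : Integrable (fun x => ‖g x‖ ^ 2) := (memLp_two_iff_integrable_sq_norm hg.1).mp hg
  -- the lattice-with-pair part (artefact 12) and its value for odd `g` (artefact 14's computation)
  have hsupp' : Function.support g ⊆ Ioc (-a) (-a + 2 * π / s) :=
    hsupp.trans (Ioc_subset_Ioc_right (by linarith))
  have hsum := soloBlind_deepPair_hasSum (-a) s 0 δ hs hg hsupp'
  obtain ⟨h0, hplus⟩ := soloBlind_odd_pair_transforms δ hodd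
  have hre : ∀ B : ℂ, 2 * (B * conj (-B)).re = -2 * ‖B‖ ^ 2 := by
    intro B
    simp only [map_neg, mul_neg, Complex.neg_re, Complex.mul_re, Complex.conj_re,
      Complex.conj_im, Complex.sq_norm, Complex.normSq_apply]
    ring
  have hval : (∑' j : ℤ, (if j = 0 then
        2 * ((∫ x : ℝ, g x * cexp (I * (((0 : ℝ) : ℂ) - I * δ) * (x : ℂ))) *
            conj ((∫ x : ℝ, g x * cexp (I * (((0 : ℝ) : ℂ) + I * δ) * (x : ℂ))))).re
      else ‖(∫ x : ℝ, g x * cexp (I * ((((0 : ℝ) + j * s : ℝ) : ℂ)) * (x : ℂ)))‖ ^ 2))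
      = (2 * π / s) * (∫ x : ℝ, ‖g x‖ ^ 2)
        - 2 * ‖∫ x : ℝ, g x * cexp (I * (((0 : ℝ) : ℂ) - I * δ) * (x : ℂ))‖ ^ 2 := by
    rw [hsum.tsum_eq, h0, hplus, norm_zero, hre]
    ring
  -- the residual `r = sinh(δ·) − Σ A_k e^{i v_k ·}` and the exponentials are continuous
  have he_cont : ∀ k, Continuous (fun x : ℝ => cexp (I * ((v k : ℝ) : ℂ) * (x : ℂ))) := fun k =>
    Complex.continuous_exp.comp (continuous_const.mul Complex.continuous_ofReal)
  have hsinh_cont : Continuous (fun x : ℝ => ((Real.sinh (δ * x) : ℝ) : ℂ)) :=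
    Complex.continuous_ofReal.comp (Real.continuous_sinh.comp (continuous_const.mul continuous_id))
  have hr_cont : Continuous (fun x : ℝ => ((Real.sinh (δ * x) : ℝ) : ℂ)
      - ∑ k ∈ t, A k * cexp (I * ((v k : ℝ) : ℂ) * (x : ℂ))) :=
    hsinh_cont.sub (continuous_finsetSum t fun k _ => continuous_const.mul (he_cont k))
  have hgr_i : Integrable (fun x => g x * (((Real.sinh (δ * x) : ℝ) : ℂ)
      - ∑ k ∈ t, A k * cexp (I * ((v k : ℝ) : ℂ) * (x : ℂ)))) :=
    soloBlind_integrable_mul_cweight hgi hsupp hr_cont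
  have hge_i : ∀ k, Integrable (fun x => g x * cexp (I * ((v k : ℝ) : ℂ) * (x : ℂ))) := fun k =>
    soloBlind_integrable_mul_cweight hgi hsupp (he_cont k)
  have hgAe_i : ∀ k ∈ t, Integrable (fun x => g x * (A k * cexp (I * ((v k : ℝ) : ℂ) * (x : ℂ)))) :=
    fun k _ => soloBlind_integrable_mul_cweight hgi hsupp (continuous_const.mul (he_cont k))
  have hcosh_i : Integrable (fun x => g x * ((Real.cosh (δ * x) : ℝ) : ℂ)) :=
    soloBlind_integrable_mul_cweight hgi hsupp
      (Complex.continuous_ofReal.comp (Real.continuous_cosh.comp (continuous_const.mul continuous_id)))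
  have hsinh_i : Integrable (fun x => g x * ((Real.sinh (δ * x) : ℝ) : ℂ)) :=
    soloBlind_integrable_mul_cweight hgi hsupp hsinh_cont
  -- `H(−iδ) = ∫ g e^{δx} = ∫ g sinh(δx) = ∫ g r + Σ A_k H(v_k)` for odd `g`
  have hcosh0 : (∫ x : ℝ, g x * ((Real.cosh (δ * x) : ℝ) : ℂ)) = 0 :=
    soloBlind_odd_mul_even_integral hodd (w := fun x => Real.cosh (δ * x))
      (fun x => by simp [Real.cosh_neg])
  have hS : (∫ x : ℝ, g x * cexp (I * (((0 : ℝ) : ℂ) - I * δ) * (x : ℂ)))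
      = (∫ x : ℝ, g x * (((Real.sinh (δ * x) : ℝ) : ℂ)
            - ∑ k ∈ t, A k * cexp (I * ((v k : ℝ) : ℂ) * (x : ℂ))))
        + ∑ k ∈ t, A k * ∫ x : ℝ, g x * cexp (I * ((v k : ℝ) : ℂ) * (x : ℂ)) := by
    have h1 : (∫ x : ℝ, g x * cexp (I * (((0 : ℝ) : ℂ) - I * δ) * (x : ℂ)))
        = (∫ x, g x * ((Real.cosh (δ * x) : ℝ) : ℂ)) + ∫ x, g x * ((Real.sinh (δ * x) : ℝ) : ℂ) := by
      rw [← integral_add hcosh_i hsinh_i]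
      congr 1; funext x
      rw [show I * (((0 : ℝ) : ℂ) - I * δ) * (x : ℂ) = ((δ * x : ℝ) : ℂ) by
        push_cast; ring_nf; rw [I_sq]; ring]
      rw [← Complex.ofReal_exp, ← Real.cosh_add_sinh]
      push_cast
      ring
    have h2 : (∫ x : ℝ, g x * ((Real.sinh (δ * x) : ℝ) : ℂ))
        = (∫ x : ℝ, g x * (((Real.sinh (δ * x) : ℝ) : ℂ)
              - ∑ k ∈ t, A k * cexp (I * ((v k : ℝ) : ℂ) * (x : ℂ))))
          + ∫ x : ℝ, ∑ k ∈ t, g x * (A k * cexp (I * ((v k : ℝ) : ℂ) * (x : ℂ))) := by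
      rw [← integral_add hgr_i (integrable_finsetSum t hgAe_i)]
      congr 1; funext x
      rw [← Finset.mul_sum]
      ring
    have h3 : (∫ x : ℝ, ∑ k ∈ t, g x * (A k * cexp (I * ((v k : ℝ) : ℂ) * (x : ℂ))))
        = ∑ k ∈ t, A k * ∫ x : ℝ, g x * cexp (I * ((v k : ℝ) : ℂ) * (x : ℂ)) := by
      rw [integral_finsetSum t hgAe_i]
      refine Finset.sum_congr rfl fun k _ => ?_
      rw [← integral_const_mul]
      congr 1; funext x; ring
    rw [h1, hcosh0, zero_add, h2, h3]
  -- abbreviations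
  set T : ℝ := 2 * π / s with hT
  set G : ℝ := ∫ x : ℝ, ‖g x‖ ^ 2 with hG
  set R : ℝ := ∫ x in Ioc (-a) a, ‖((Real.sinh (δ * x) : ℝ) : ℂ)
      - ∑ k ∈ t, A k * cexp (I * ((v k : ℝ) : ℂ) * (x : ℂ))‖ ^ 2 with hR
  set P : ℝ := ∑ k ∈ t, ‖A k‖ ^ 2 / m k with hP
  set Cr : ℝ := ∑ k ∈ t, m k * ‖∫ x : ℝ, g x * cexp (I * ((v k : ℝ) : ℂ) * (x : ℂ))‖ ^ 2 with hCr
  have hG0 : 0 ≤ G := integral_nonneg fun x => by positivity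
  have hR0 : 0 ≤ R := integral_nonneg fun x => by positivity
  have hP0 : 0 ≤ P := Finset.sum_nonneg fun k hk => div_nonneg (by positivity) (hm k hk).le
  have hCr0 : 0 ≤ Cr := Finset.sum_nonneg fun k hk => mul_nonneg (hm k hk).le (by positivity)
  -- window term: `2|∫ g r| ≤ λ T G + R/(λ T)` (pointwise AM–GM, integrated)
  have hwin : ∀ l : ℝ, 0 < l →
      2 * ‖∫ x : ℝ, g x * (((Real.sinh (δ * x) : ℝ) : ℂ)
            - ∑ k ∈ t, A k * cexp (I * ((v k : ℝ) : ℂ) * (x : ℂ)))‖ ≤ l * (T * G) + (R / T) / l := by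
    intro l hl
    have hc : 0 < l * T := mul_pos hl hTpos
    -- the dominating function
    have hind_i : Integrable (Set.indicator (Ioc (-a) a) (fun x : ℝ => ‖((Real.sinh (δ * x) : ℝ) : ℂ)
        - ∑ k ∈ t, A k * cexp (I * ((v k : ℝ) : ℂ) * (x : ℂ))‖ ^ 2)) := by
      refine IntegrableOn.integrable_indicator ?_ measurableSet_Ioc
      exact ((hr_cont.norm.pow 2).integrableOn_Icc).mono_set Ioc_subset_Icc_self
    have hdom_i : Integrable (fun x : ℝ => ((l * T) * ‖g x‖ ^ 2
        + Set.indicator (Ioc (-a) a) (fun x : ℝ => ‖((Real.sinh (δ * x) : ℝ) : ℂ)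
            - ∑ k ∈ t, A k * cexp (I * ((v k : ℝ) : ℂ) * (x : ℂ))‖ ^ 2) x / (l * T)) / 2) :=
      ((hg2.const_mul (l * T)).add (hind_i.div_const (l * T))).div_const 2
    have hpt : ∀ x : ℝ, ‖g x * (((Real.sinh (δ * x) : ℝ) : ℂ)
        - ∑ k ∈ t, A k * cexp (I * ((v k : ℝ) : ℂ) * (x : ℂ)))‖
        ≤ ((l * T) * ‖g x‖ ^ 2
          + Set.indicator (Ioc (-a) a) (fun x : ℝ => ‖((Real.sinh (δ * x) : ℝ) : ℂ)
              - ∑ k ∈ t, A k * cexp (I * ((v k : ℝ) : ℂ) * (x : ℂ))‖ ^ 2) x / (l * T)) / 2 := by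
      intro x
      by_cases hx : g x = 0
      · simp only [hx, zero_mul, norm_zero]
        have : 0 ≤ Set.indicator (Ioc (-a) a) (fun x : ℝ => ‖((Real.sinh (δ * x) : ℝ) : ℂ)
            - ∑ k ∈ t, A k * cexp (I * ((v k : ℝ) : ℂ) * (x : ℂ))‖ ^ 2) x :=
          Set.indicator_nonneg (fun y _ => by positivity) x
        positivity
      · have hxI : x ∈ Ioc (-a) a := hsupp hx
        rw [Set.indicator_of_mem hxI, norm_mul]
        have h := soloBlind_two_mul_le_weighted ‖g x‖ ‖((Real.sinh (δ * x) : ℝ) : ℂ)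
            - ∑ k ∈ t, A k * cexp (I * ((v k : ℝ) : ℂ) * (x : ℂ))‖ (l * T) hc
        linarith
    have hI := norm_integral_le_of_norm_le hdom_i (Filter.Eventually.of_forall hpt)
    have hIval : (∫ x : ℝ, ((l * T) * ‖g x‖ ^ 2
        + Set.indicator (Ioc (-a) a) (fun x : ℝ => ‖((Real.sinh (δ * x) : ℝ) : ℂ)
            - ∑ k ∈ t, A k * cexp (I * ((v k : ℝ) : ℂ) * (x : ℂ))‖ ^ 2) x / (l * T)) / 2)
        = ((l * T) * G + R / (l * T)) / 2 := by
      rw [integral_div, integral_add (hg2.const_mul (l * T)) (hind_i.div_const (l * T)),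
        integral_const_mul, integral_div, integral_indicator measurableSet_Ioc]
    rw [hIval] at hI
    have hRT : R / (l * T) = (R / T) / l := by
      field_simp
    rw [hRT] at hI
    nlinarith [hI]
  -- crowd term: `2|Σ A_k H_k| ≤ λ Cr + P/λ` (termwise AM–GM)
  have hfin : ∀ l : ℝ, 0 < l →
      2 * ‖∑ k ∈ t, A k * ∫ x : ℝ, g x * cexp (I * ((v k : ℝ) : ℂ) * (x : ℂ))‖ ≤ l * Cr + P / l := by
    intro l hl
    have h1 : ‖∑ k ∈ t, A k * ∫ x : ℝ, g x * cexp (I * ((v k : ℝ) : ℂ) * (x : ℂ))‖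
        ≤ ∑ k ∈ t, ‖A k‖ * ‖∫ x : ℝ, g x * cexp (I * ((v k : ℝ) : ℂ) * (x : ℂ))‖ := by
      refine (norm_sum_le _ _).trans (Finset.sum_le_sum fun k _ => ?_)
      rw [norm_mul]
    have h2 : ∀ k ∈ t, 2 * (‖A k‖ * ‖∫ x : ℝ, g x * cexp (I * ((v k : ℝ) : ℂ) * (x : ℂ))‖)
        ≤ (l * m k) * ‖∫ x : ℝ, g x * cexp (I * ((v k : ℝ) : ℂ) * (x : ℂ))‖ ^ 2
          + ‖A k‖ ^ 2 / (l * m k) := by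
      intro k hk
      have h := soloBlind_two_mul_le_weighted ‖∫ x : ℝ, g x * cexp (I * ((v k : ℝ) : ℂ) * (x : ℂ))‖
        ‖A k‖ (l * m k) (mul_pos hl (hm k hk))
      linarith
    have h3 : 2 * ∑ k ∈ t, ‖A k‖ * ‖∫ x : ℝ, g x * cexp (I * ((v k : ℝ) : ℂ) * (x : ℂ))‖
        ≤ ∑ k ∈ t, ((l * m k) * ‖∫ x : ℝ, g x * cexp (I * ((v k : ℝ) : ℂ) * (x : ℂ))‖ ^ 2
          + ‖A k‖ ^ 2 / (l * m k)) := by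
      rw [Finset.mul_sum]
      exact Finset.sum_le_sum h2
    have h4 : ∑ k ∈ t, ((l * m k) * ‖∫ x : ℝ, g x * cexp (I * ((v k : ℝ) : ℂ) * (x : ℂ))‖ ^ 2
          + ‖A k‖ ^ 2 / (l * m k)) = l * Cr + P / l := by
      rw [Finset.sum_add_distrib, hCr, hP, Finset.mul_sum, Finset.sum_div]
      congr 1
      · refine Finset.sum_congr rfl fun k _ => ?_; ring
      · refine Finset.sum_congr rfl fun k hk => ?_
        rw [div_div, mul_comm l (m k)]
    linarith [h1, h3, h4]
  -- combine: `2|H(−iδ)| ≤ λ (T G + Cr) + (R/T + P)/λ` for every `λ > 0`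
  have hamgm : ∀ l : ℝ, 0 < l →
      2 * ‖∫ x : ℝ, g x * cexp (I * (((0 : ℝ) : ℂ) - I * δ) * (x : ℂ))‖
        ≤ l * (T * G + Cr) + (R / T + P) / l := by
    intro l hl
    rw [hS]
    have hn := norm_add_le (∫ x : ℝ, g x * (((Real.sinh (δ * x) : ℝ) : ℂ)
            - ∑ k ∈ t, A k * cexp (I * ((v k : ℝ) : ℂ) * (x : ℂ))))
        (∑ k ∈ t, A k * ∫ x : ℝ, g x * cexp (I * ((v k : ℝ) : ℂ) * (x : ℂ)))
    have hw := hwin l hl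
    have hf := hfin l hl
    have : l * (T * G + Cr) + (R / T + P) / l = (l * (T * G) + (R / T) / l) + (l * Cr + P / l) := by
      rw [add_div]; ring
    rw [this]
    linarith
  have hsq := soloBlind_sq_le_of_forall_amgm
    ‖∫ x : ℝ, g x * cexp (I * (((0 : ℝ) : ℂ) - I * δ) * (x : ℂ))‖ (T * G + Cr) (R / T + P)
    (norm_nonneg _) (by positivity) (by positivity) hamgm
  -- conclude
  rw [hval]
  have hJ : R / T + P ≤ 1 / 2 := hcert
  have hY : 0 ≤ T * G + Cr := by positivity
  nlinarith [hsq, hJ, hY, mul_le_mul_of_nonneg_right hJ hY]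

end Summit.RiemannHypothesis.RiemannHypothesis.Theorems
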